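import Literature.NumberTheory.EllipticCurves.CanonicalPAdicHeightNumeratorProofs
import Literature.NumberTheory.EllipticCurves.CanonicalPAdicHeightAdmissibilityCriteria
import Literature.NumberTheory.EllipticCurves.CanonicalPAdicHeightIntegralityProofs
import HarnessLib

/-!
# BirchSwinnertonDyer / CountingDoorF2AtThree — crux I4loc `SchneiderOnDoorSubfamily`
# (stmt-BirchSwinnertonDyer-19682), line `valuation-class-at-three` (v3): the `3`-adic digit toolkit
# behind STUB 1 `stub_heightDigits`

Helper file (`--supports stmt-BirchSwinnertonDyer-19682 --as helper`; cell bsd-rank2, seat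
cd-valclass-digits; PARTITION: none — r_an ≥ 2, summit axis S0; B1: `p`-adic height algebra, nothing
reads an analytic rank). Theorems only, in tree vocabulary:

* §1 `norm_padicLog_intCast_sub_le` — **the first `3`-adic digit of `log₃ m`**: for `3 ∤ m` and an
  integer `d` with `9 ∣ m² − 1 − 6d`, `‖log₃ m − 3d‖₃ ≤ 3⁻²` (`log₃ m = ½ log₃(m²)`,
  `‖L(1+z) − z‖ ≤ ‖z‖²` on `3ℤ₃`); packaged as `norm_div_three_sub_lt_one_of_norm_sub_padicLog_le`:
  `‖A − log₃ m‖ ≤ 3⁻²` ⇒ `‖A/3 − d‖ < 1` (the hypothesis shape of the digit-certificate kernel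
  `Theorems.schneiderConjecture_of_nonresidue_digits`, p452361).
* §2 `padicSigma_eq_X_of_not_exists`, `padicSigmaEval_eq_self_of_padicSigma_eq_X` — the JUNK branch of
  the tree's `padicSigma` (no Mazur–Tate pair ⇒ `σ = t`), and
  `PAdicHeightData.not_isCanonical_of_padicSigma_eq_X` — **on the junk branch no height datum is
  canonical** as soon as `‖a₁‖_p = 1` and some point `P ∈ E₁(ℚ_p)` has `P` and `−P` admissible: the
  junk formula `log_p den x − 2 log_p(−x/y)` is not even (`ĥ(P) − ĥ(−P) = 2 log_p(1 − a₁z + a₃/y) ≠ 0`),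
  while every bilinear datum is. This is what makes STUB 1 UNCONDITIONAL: the genuine branch is served by
  the Mazur–Tate pair property of `padicSigma`, the junk branch is empty.
* §3 `norm_pairing_self_le_inv_of_mem_kernelOfReductionAt` — **`⟨Q,Q⟩ ∈ pℤ_p` for every rational point
  of `E₁(ℚ_p)` on a type-∅ equation** (canonical datum, `p ≥ 3`): the cross-term bound
  `‖⟨2P₁+3P₂, 2P₁+3P₂⟩‖ ≤ 3⁻¹` of the two-height certificate (`kernelOfReductionAt` is a subgroup).

References: Mazur–Stein–Tate 2006 §1 [MazurSteinTate2006]; Harvey 2008 §5 [Harvey2008];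
Iwasawa 1972 §4.4 [Iwasawa1972PadicL]; Silverman AEC VII.2 [SilvermanAEC2009].
-/

set_option linter.dupNamespace false

noncomputable section

open scoped Classical
open PowerSeries WeierstrassCurve Literature.NumberTheory.EllipticCurves

namespace Summit.BirchSwinnertonDyer.BirchSwinnertonDyer.Theorems

/-! ### §1 The first `3`-adic digit of `log₃` of an integer -/

section LogDigit

/-- `‖2‖₃ = 1`. [folklore] -/
theorem norm_two_padic_three : ‖(2 : ℚ_[3])‖ = 1 := by
  rw [show (2 : ℚ_[3]) = ((2 : ℕ) : ℚ_[3]) by norm_cast, Padic.norm_natCast_eq_one_iff]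
  decide

/-- `3ⁿ ∣ k ⇒ ‖k‖₃ ≤ 3⁻ⁿ` for an integer `k`. [folklore] -/
theorem norm_intCast_le_of_pow_three_dvd {k : ℤ} {n : ℕ} (h : (3 : ℤ) ^ n ∣ k) :
    ‖(k : ℚ_[3])‖ ≤ (3 : ℝ)⁻¹ ^ n := by
  have := (Padic.norm_int_le_pow_iff_dvd k n).mpr (by exact_mod_cast h)
  rw [inv_pow, ← zpow_natCast, ← zpow_neg]
  exact_mod_cast this

/-- **`‖log₃(m²) − (m² − 1)‖₃ ≤ 3⁻²` for `3 ∤ m`** (`m² ≡ 1 (mod 3)` and `‖L(1+z) − z‖ ≤ ‖z‖²·‖2⁻¹‖`).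
[cite: Iwasawa1972PadicL, §4.4] -/
theorem norm_padicLog_sq_sub_le {m : ℤ} (hm : ¬ (3 : ℤ) ∣ m) :
    ‖padicLog 3 ((m : ℚ_[3]) ^ 2) - ((m : ℚ_[3]) ^ 2 - 1)‖ ≤ (3 : ℝ)⁻¹ ^ 2 := by
  -- `3 ∣ m² − 1`
  have h3 : (3 : ℤ) ∣ m ^ 2 - 1 := by
    have hcop : IsCoprime m (3 : ℤ) :=
      (Int.isCoprime_iff_gcd_eq_one.mpr (by
        have := Int.gcd_dvd_right m 3
        have h1 : (Int.gcd m 3 : ℤ) ∣ 3 := this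
        have hprime : Nat.Prime 3 := Nat.prime_three
        rcases (Nat.dvd_prime hprime).mp (by exact_mod_cast h1) with h | h
        · exact h
        · exfalso; apply hm
          have := Int.gcd_dvd_left m 3
          rw [h] at this; exact_mod_cast this))
    have := Int.ModEq.pow_card_sub_one_eq_one Nat.prime_three hcop
    exact (Int.ModEq.dvd this.symm)
  have hz : ‖1 - ((m : ℚ_[3]) ^ 2)‖ ≤ (3 : ℝ)⁻¹ := by
    rw [norm_sub_rev, show ((m : ℚ_[3]) ^ 2 - 1) = (((m ^ 2 - 1 : ℤ)) : ℚ_[3]) by push_cast; ring]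
    have := norm_intCast_le_of_pow_three_dvd (n := 1) (k := m ^ 2 - 1) (by rw [pow_one]; exact h3)
    rwa [pow_one] at this
  have hz1 : ‖1 - ((m : ℚ_[3]) ^ 2)‖ < 1 := hz.trans_lt (by norm_num)
  rw [padicLog_eq_padicLogSeries hz1,
    show padicLogSeries 3 ((m : ℚ_[3]) ^ 2) - ((m : ℚ_[3]) ^ 2 - 1) =
      padicLogSeries 3 ((m : ℚ_[3]) ^ 2) + (1 - (m : ℚ_[3]) ^ 2) by ring]
  refine (norm_padicLogSeries_add_le hz1).trans ?_
  rw [norm_inv, norm_two_padic_three, inv_one, mul_one]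
  exact pow_le_pow_left₀ (norm_nonneg _) hz 2

/-- **The first `3`-adic digit of `log₃ m`.** For an integer `m` with `3 ∤ m` and an integer `d` with
`9 ∣ m² − 1 − 6d` (i.e. `d ≡ (m² − 1)/6 (mod 3)`: `m ≡ ±1 ↦ 0`, `±2 ↦ 2`, `±4 ↦ 1 (mod 9)`):
`‖log₃ m − 3d‖₃ ≤ 3⁻²`. [cite: Iwasawa1972PadicL, §4.4] -/
theorem norm_padicLog_intCast_sub_le {m d : ℤ} (hm : ¬ (3 : ℤ) ∣ m) (hd : (9 : ℤ) ∣ m ^ 2 - 1 - 6 * d) :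
    ‖padicLog 3 (m : ℚ_[3]) - 3 * (d : ℚ_[3])‖ ≤ (3 : ℝ)⁻¹ ^ 2 := by
  have hm0 : (m : ℚ_[3]) ≠ 0 := by exact_mod_cast fun h => hm (by rw [h]; exact dvd_zero 3)
  have hsq := norm_padicLog_sq_sub_le hm
  rw [padicLog_sq hm0] at hsq
  -- `2 (log m − 3d) = (log m² − (m² − 1)) + (m² − 1 − 6d)`
  have key : padicLog 3 (m : ℚ_[3]) - 3 * (d : ℚ_[3]) =
      2⁻¹ * ((2 * padicLog 3 (m : ℚ_[3]) - ((m : ℚ_[3]) ^ 2 - 1)) +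
        (((m ^ 2 - 1 - 6 * d : ℤ)) : ℚ_[3])) := by
    push_cast; field_simp; ring
  rw [key, norm_mul, norm_inv, norm_two_padic_three, inv_one, one_mul]
  refine (IsUltrametricDist.norm_add_le_max _ _).trans (max_le hsq ?_)
  exact norm_intCast_le_of_pow_three_dvd (n := 2) (by norm_num; exact hd)

/-- **From `log₃` to the certificate shape.** If `‖A − log₃ m‖₃ ≤ 3⁻²` with `3 ∤ m` and
`9 ∣ m² − 1 − 6d`, then `‖A/3 − d‖₃ < 1` (indeed `≤ 3⁻¹`). [cite: MazurSteinTate2006, §1 eq. (1.1)] -/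
theorem norm_div_three_sub_lt_one_of_norm_sub_padicLog_le {A : ℚ_[3]} {m d : ℤ} (hm : ¬ (3 : ℤ) ∣ m)
    (hd : (9 : ℤ) ∣ m ^ 2 - 1 - 6 * d) (hA : ‖A - padicLog 3 (m : ℚ_[3])‖ ≤ (3 : ℝ)⁻¹ ^ 2) :
    ‖A / 3 - (d : ℚ_[3])‖ < 1 := by
  have h3 : ‖(3 : ℚ_[3])‖ = (3 : ℝ)⁻¹ := by exact_mod_cast Padic.norm_p (p := 3)
  have h30 : (3 : ℚ_[3]) ≠ 0 := by norm_num
  have hAd : ‖A - 3 * (d : ℚ_[3])‖ ≤ (3 : ℝ)⁻¹ ^ 2 := by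
    rw [show A - 3 * (d : ℚ_[3]) = (A - padicLog 3 (m : ℚ_[3])) +
      (padicLog 3 (m : ℚ_[3]) - 3 * (d : ℚ_[3])) by ring]
    exact (IsUltrametricDist.norm_add_le_max _ _).trans (max_le hA (norm_padicLog_intCast_sub_le hm hd))
  have e : A / 3 - (d : ℚ_[3]) = 3⁻¹ * (A - 3 * (d : ℚ_[3])) := by field_simp
  rw [e, norm_mul, norm_inv, h3, inv_inv]
  calc (3 : ℝ) * ‖A - 3 * (d : ℚ_[3])‖ ≤ 3 * ((3 : ℝ)⁻¹ ^ 2) := by gcongr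
    _ < 1 := by norm_num

end LogDigit

/-! ### §2 The junk branch of `padicSigma` carries no canonical datum -/

section Junk

variable {p : ℕ} [Fact p.Prime]

/-- If `W ⊗ ℚ_p` has no Mazur–Tate pair, the tree's `padicSigma` is the junk value `t`.
[cite: MazurSteinTate2006, Thm. 1.3] -/
theorem padicSigma_eq_X_of_not_exists (V : WeierstrassCurve ℚ_[p])
    (h : ¬ ∃ σ : ℚ_[p]⟦X⟧, ∃ c : ℚ_[p], V.IsMazurTateSigmaPair σ c) : V.padicSigma = X := by
  have h' : ¬ ∃ σc : ℚ_[p]⟦X⟧ × ℚ_[p], V.IsMazurTateSigmaPair σc.1 σc.2 := by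
    rintro ⟨σc, hσc⟩; exact h ⟨σc.1, σc.2, hσc⟩
  unfold padicSigma mazurTatePair
  rw [dif_neg h']

/-- On the junk branch `σ = t`, so `σ_p(t) = t` for every `t`. [cite: MazurSteinTate2006, Thm. 1.3] -/
theorem padicSigmaEval_eq_self_of_padicSigma_eq_X (W : WeierstrassCurve ℚ)
    (hσ : (W.baseChange ℚ_[p]).padicSigma = X) (t : ℚ_[p]) : W.padicSigmaEval p t = t := by
  unfold padicSigmaEval
  rw [hσ, tsum_eq_single 1]
  · simp [coeff_X]
  · intro n hn
    rw [coeff_X, if_neg hn, zero_mul]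

/-- `log_p(a/b) = log_p a − log_p b` for `a, b ≠ 0`. [cite: Iwasawa1972PadicL, §4.4] -/
theorem padicLog_div {a b : ℚ_[p]} (ha : a ≠ 0) (hb : b ≠ 0) :
    padicLog p (a / b) = padicLog p a - padicLog p b := by
  have h := padicLog_mul_holds p (div_ne_zero ha hb) hb
  rw [div_mul_cancel₀ a hb] at h
  linear_combination -h

variable (W : WeierstrassCurve ℚ) [W.IsIntegral ℤ]

/-- **The junk sigma formula is not even.** For a `ℤ`-integral equation, `p` odd, `‖a₁‖_p = 1`, on
the junk branch `σ = t`, a point `P = (x, y)` with `‖x‖_p > 1` has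
`ĥ_p(P) − ĥ_p(−P) = −2 log_p((−x/y)/(−x/y')) = 2 log_p(−y'/y)`, `y' = −y − a₁x − a₃`, and
`−y'/y = 1 − a₁z(P) + a₃/y` is a principal unit at distance EXACTLY `‖z(P)‖ ≠ 0` from `1`; so the two
junk values differ. [cite: MazurSteinTate2006, §1 eq. (1.1)] -/
theorem canonicalPAdicHeight_ne_neg_of_padicSigma_eq_X (hp : p ≠ 2) (ha₁ : ‖(W.a₁ : ℚ_[p])‖ = 1)
    (hσ : (W.baseChange ℚ_[p]).padicSigma = X) {x y : ℚ} (h : W.toAffine.Nonsingular x y)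
    (hx : 1 < ‖(x : ℚ_[p])‖) :
    W.canonicalPAdicHeight p (.some x y h) ≠ W.canonicalPAdicHeight p (-(.some x y h)) := by
  rw [Affine.Point.neg_some, canonicalPAdicHeight_some, canonicalPAdicHeight_some, padicSigmaAt,
    padicSigmaAt, padicParam_some, padicParam_some, padicSigmaEval_eq_self_of_padicSigma_eq_X W hσ,
    padicSigmaEval_eq_self_of_padicSigma_eq_X W hσ]
  -- norms of the coordinates
  obtain ⟨hY, -⟩ := W.inSigmaDisc_of_one_lt_norm hp h hx
  set X₀ : ℚ_[p] := (x : ℚ_[p]) with hX₀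
  set Y₀ : ℚ_[p] := (y : ℚ_[p]) with hY₀
  have hX0 : X₀ ≠ 0 := by rintro h0; rw [h0, norm_zero] at hx; exact not_lt.mpr zero_le_one hx
  have htsq : ‖X₀ / Y₀‖ ^ 2 = ‖X₀‖⁻¹ := norm_div_sq_eq_inv_norm_of_one_lt_norm h hx
  have ht1 : ‖X₀ / Y₀‖ < 1 := by
    have : ‖X₀ / Y₀‖ ^ 2 < 1 := by rw [htsq]; exact inv_lt_one_of_one_lt₀ hx
    exact (pow_lt_one_iff_of_nonneg (norm_nonneg _) two_ne_zero).mp this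
  have ht0 : X₀ / Y₀ ≠ 0 := div_ne_zero hX0 hY
  have htpos : 0 < ‖X₀ / Y₀‖ := norm_pos_iff.mpr ht0
  -- `‖1/Y₀‖ = ‖X₀/Y₀‖³ < ‖X₀/Y₀‖`
  have hYinv : ‖Y₀⁻¹‖ = ‖X₀ / Y₀‖ ^ 3 := by
    have e : Y₀⁻¹ = (X₀ / Y₀) * X₀⁻¹ := by field_simp
    rw [e, norm_mul, norm_inv, ← htsq]; ring
  have ha₁' : ‖(W.a₁ : ℚ_[p]) * (X₀ / Y₀)‖ = ‖X₀ / Y₀‖ := by rw [norm_mul, ha₁, one_mul]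
  have ha₃ : ‖(W.a₃ : ℚ_[p])‖ ≤ 1 := (mem_localIntegers_iff p _).mp (W.a₃_mem_localIntegers p)
  have hsmall : ‖(W.a₃ : ℚ_[p]) * Y₀⁻¹‖ < ‖(W.a₁ : ℚ_[p]) * (X₀ / Y₀)‖ := by
    rw [ha₁', norm_mul, hYinv]
    calc ‖(W.a₃ : ℚ_[p])‖ * ‖X₀ / Y₀‖ ^ 3 ≤ 1 * ‖X₀ / Y₀‖ ^ 3 := by gcongr
      _ = ‖X₀ / Y₀‖ ^ 2 * ‖X₀ / Y₀‖ := by ring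
      _ < 1 * ‖X₀ / Y₀‖ := by
          gcongr; exact pow_lt_one₀ (norm_nonneg _) ht1 two_ne_zero
      _ = ‖X₀ / Y₀‖ := one_mul _
  -- the ratio of the two parameters is the principal unit `u = 1 + a₁ x/y + a₃/y` (up to sign)
  set w : ℚ_[p] := (W.a₁ : ℚ_[p]) * (X₀ / Y₀) + (W.a₃ : ℚ_[p]) * Y₀⁻¹ with hw
  have hwnorm : ‖w‖ = ‖X₀ / Y₀‖ := by
    rw [hw, ← ha₁', Padic.add_eq_max_of_ne (ne_of_gt hsmall), max_eq_left hsmall.le]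
  have hw1 : ‖1 - (1 + w)‖ < 1 := by rw [sub_add_cancel_left, norm_neg, hwnorm]; exact ht1
  have h1w0 : 1 + w ≠ 0 := by
    intro h0; rw [h0, sub_zero, norm_one] at hw1; exact lt_irrefl _ hw1
  -- the negated `y`-coordinate is `-(Y₀ (1 + w))`
  have hY' : ((W.toAffine.negY x y : ℚ) : ℚ_[p]) = -(Y₀ * (1 + w)) := by
    rw [Affine.negY, hw]; push_cast; field_simp; ring
  have hY'0 : ((W.toAffine.negY x y : ℚ) : ℚ_[p]) ≠ 0 := by
    rw [hY']; exact neg_ne_zero.mpr (mul_ne_zero hY h1w0)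
  intro hEq
  -- cancel `log(den x)` and the factor `2`
  have h2 : padicLog p (-X₀ / Y₀) = padicLog p (-X₀ / ((W.toAffine.negY x y : ℚ) : ℚ_[p])) := by
    linear_combination (-(1 : ℚ_[p]) / 2) * hEq
  -- the quotient of the two arguments is `-(1 + w)`
  have hq : (-X₀ / Y₀) / (-X₀ / ((W.toAffine.negY x y : ℚ) : ℚ_[p])) = -(1 + w) := by
    rw [hY']; field_simp
  have hlog : padicLog p (-(1 + w)) = 0 := by
    rw [← hq, padicLog_div (div_ne_zero (neg_ne_zero.mpr hX0) hY)
      (div_ne_zero (neg_ne_zero.mpr hX0) hY'0), h2, sub_self]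
  rw [padicLog_neg h1w0, padicLog_eq_padicLogSeries hw1] at hlog
  have hnorm := norm_padicLogSeries_eq (p := p) (y := 1 + w) (by
    rw [sub_add_cancel_left, norm_neg, hwnorm]
    have h2n : ‖(2 : ℚ_[p])‖ = 1 := by
      rw [show (2 : ℚ_[p]) = ((2 : ℕ) : ℚ_[p]) by norm_cast, Padic.norm_natCast_eq_one_iff]
      exact (Nat.coprime_primes Fact.out Nat.prime_two).mpr hp
    rw [h2n]; exact ht1)
  rw [hlog, norm_zero, sub_add_cancel_left, norm_neg, hwnorm] at hnorm
  exact (ne_of_gt htpos) hnorm.symm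

/-- **No canonical datum on the junk branch.** If `W ⊗ ℚ_p` has no Mazur–Tate pair (`p` odd,
`ℤ`-integral equation with `‖a₁‖_p = 1`) and some `P = (x, y) ∈ E(ℚ)` with `‖x‖_p > 1` has both `P`
and `−P` admissible, then NO `p`-adic height datum of `W` is canonical in the tree's sense (a bilinear
pairing is even, the junk sigma formula is not). In particular every statement "for every canonical
datum …" about such a curve holds, and the genuine Mazur–Tate branch is the only one with content.
[cite: MazurSteinTate2006, §1 eq. (1.1) and Thm. 1.3] -/
theorem PAdicHeightData.not_isCanonical_of_not_exists_pair (hp : p ≠ 2) (ha₁ : ‖(W.a₁ : ℚ_[p])‖ = 1)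
    (hσ : ¬ ∃ σ : ℚ_[p]⟦X⟧, ∃ c : ℚ_[p], (W.baseChange ℚ_[p]).IsMazurTateSigmaPair σ c)
    {x y : ℚ} {h : W.toAffine.Nonsingular x y} (hP : W.IsAdmissible p (.some x y h))
    (hP' : W.IsAdmissible p (-(.some x y h))) (D : PAdicHeightData W p) : ¬ D.IsCanonical := by
  intro hD
  have e₁ := hD _ hP
  have e₂ := hD _ hP'
  have hpair : D.pairing (-(.some x y h)) (-(.some x y h)) = D.pairing (.some x y h) (.some x y h) := by
    simp only [map_neg, AddMonoidHom.neg_apply, neg_neg]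
  rw [hpair, e₁] at e₂
  exact canonicalPAdicHeight_ne_neg_of_padicSigma_eq_X W hp ha₁
    (padicSigma_eq_X_of_not_exists _ hσ) h hP.2.1 e₂

end Junk

/-! ### §3 Heights of rational points of `E₁(ℚ_p)` on a type-∅ equation lie in `pℤ_p` -/

section Kernel

variable {p : ℕ} [Fact p.Prime] (W : WeierstrassCurve ℚ) [W.IsIntegral ℤ]

/-- **`‖⟨Q, Q⟩‖_p ≤ p⁻¹` for every rational point `Q` reducing to `Õ` modulo `p`** (canonical datum,
`p ≥ 3`, `ℤ`-integral equation on which EVERY rational point has non-singular reduction at every prime —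
type ∅): either `Q = O`, or `Q = (x, y)` with `‖x‖_p > 1` is admissible and
`⟨Q,Q⟩ = log_p(num x) + O(‖x/y‖_p)` with `log_p(ℚ_p^×) ⊆ pℤ_p`.
[cite: MazurSteinTate2006, §1 eq. (1.1)] [cite: Harvey2008, §5] -/
theorem norm_pairing_self_le_inv_of_mem_kernelOfReductionAt (hp : 3 ≤ p)
    (hred : ∀ (x y : ℚ), W.toAffine.Nonsingular x y → ∀ ℓ : ℕ, ℓ.Prime → W.HasNonsingularReductionAt ℓ x y)
    {D : PAdicHeightData W p} (hD : D.IsCanonical) {Q : W.toAffine.Point}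
    (hQ : Q ∈ W.kernelOfReductionAt p) : ‖D.pairing Q Q‖ ≤ (p : ℝ)⁻¹ := by
  have hp2 : p ≠ 2 := by omega
  rcases Q with _ | ⟨x, y, h⟩
  · rw [show (Affine.Point.zero : W.toAffine.Point) = 0 from rfl, map_zero, norm_zero]
    positivity
  · have hx : 1 < ‖(x : ℚ_[p])‖ := (some_mem_kernelOfReductionAt_iff h).mp hQ
    have hadm : W.IsAdmissible p (.some x y h) := W.isAdmissible_of_one_lt_norm hp h hx (hred x y h)
    have hsub := hD.norm_pairing_self_sub_padicLog_num_le _ _ hp2 hadm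
    have hz : ‖(x : ℚ_[p]) / y‖ ≤ (p : ℝ)⁻¹ := by
      refine norm_le_inv_of_norm_lt_one ?_
      have h2 := norm_div_sq_eq_inv_norm_of_one_lt_norm (p := p) h hx
      have hlt : ‖(x : ℚ_[p]) / y‖ ^ 2 < 1 := by rw [h2]; exact inv_lt_one_of_one_lt₀ hx
      exact (pow_lt_one_iff_of_nonneg (norm_nonneg _) two_ne_zero).mp hlt
    calc ‖D.pairing (.some x y h) (.some x y h)‖
        = ‖(D.pairing (.some x y h) (.some x y h) - padicLog p (x.num : ℚ_[p])) +
            padicLog p (x.num : ℚ_[p])‖ := by rw [sub_add_cancel]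
      _ ≤ max ‖D.pairing (.some x y h) (.some x y h) - padicLog p (x.num : ℚ_[p])‖
            ‖padicLog p (x.num : ℚ_[p])‖ := IsUltrametricDist.norm_add_le_max _ _
      _ ≤ (p : ℝ)⁻¹ := max_le (hsub.trans hz) (norm_padicLog_le_inv hp2 _)

/-- An affine rational point with `‖x‖_p > 1` lies in `E₁(ℚ_p) ∩ E(ℚ)` (restated for sums).
[cite: SilvermanAEC2009, VII.2.2] -/
theorem some_mem_kernelOfReductionAt {x y : ℚ} (h : W.toAffine.Nonsingular x y)
    (hx : 1 < ‖(x : ℚ_[p])‖) : (.some x y h : W.toAffine.Point) ∈ W.kernelOfReductionAt p :=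
  (some_mem_kernelOfReductionAt_iff h).mpr hx

end Kernel

end Summit.BirchSwinnertonDyer.BirchSwinnertonDyer.Theorems

end
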